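import Literature.Analysis.ValidatedNumerics.TaylorModel
import HarnessLib

/-!
# Linear combinations, powers and Horner sums of Taylor models with interval coefficients

Trunk T-ANA (Analysis/ValidatedNumerics); namespace `Literature.Analysis.ValidatedNumerics.PolyMP`.
Sequel of `TaylorModel.lean`.  Kernel certificates that evaluate a truncated power series
`Σ_k a_k · u(ρ)^k` whose COEFFICIENTS are only known through interval enclosures `a_k ∈ C_k`
(e.g. Frobenius coefficients produced by an interval recursion) and whose ARGUMENT `u(ρ)` is a
Taylor model in the panel variable `ρ` need three list-level operations and their soundness:

* `tlinComb S cs Ps = Σ_k cs_k · Ps_k` — a linear combination of Taylor models with interval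
  scalars, computed by ONE left fold (`tmem_linComb`, `tmem_linComb_ofFn`);
* `tpowers S h D U m = [U^0, U^1, …, U^m]` — the list of truncated powers of a Taylor model, computed
  by ONE left fold (`tpowers_eq` identifies it with the clean recursion `tpow`; `tmem_tpow`,
  `tmem_powers`, `length_tpowers`);
* `thornerMI S h D cs U = Σ_k cs_k · U^k` by Horner's rule (`tmem_thornerMI`);

together with the two fold lemmas everything rests on: `tmem_foldl_taddI` (a left fold of `taddI`
over any list encloses the accumulated sum, index-wise hypotheses) and its scalar analogue
`mem_foldl_add_list` for `MI` (`sumMI`, `mem_sumMI`), and the convenience instance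
`tmem_foldl_mul_powers` / `tmem_foldl_zipIdx_mul_powers` / `tmem_mul_foldl_zipIdx_mul_powers`
(`Σ_i R_i(ρ) · u(ρ)^i` with Taylor-model coefficients `R_i`, powers read from `tpowers`, index list
`zip (range n)` or `zipIdx`).  The definitions take the scale `S` as an explicit first argument and are otherwise
written exactly in the fold shapes used by `decide`-evaluated certificate modules, so that a module
working at a fixed scale `S₀` may either call them directly or define local abbreviations that agree
with them by `rfl`.  Computable; no facts, no axioms beyond the standard three.

## References

* K. Makino, M. Berz, *Taylor models and other validated functional inclusion methods*,
  Int. J. Pure Appl. Math. 4 (2003), 379–456 — §2: Def 1 (Taylor model), Def 2 (addition and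
  multiplication), Thm 2 (FTTMA: executing a finite code list of Taylor-model operations yields a
  Taylor model of the composite); held as `paper:galaxy-pdf-578413100` (chunk locators `pNNNN:Ln`).
  [cite: MakinoBerz2003, Def 1–2 and Thm 2]
-/

namespace Literature.Analysis.ValidatedNumerics

namespace PolyMP

open Literature.Analysis.ValidatedNumerics.NumericsMP
open Finset

variable {S : ℕ} {h : ℚ}

/-! ### Transport along a pointwise identity -/

/-- A Taylor model of `f` on `|ρ| ≤ h` is a Taylor model of any `g` that agrees with `f` there.
[cite: MakinoBerz2003, Def 1 eq. (2.1) (membership depends only on the values of f on D), chunk p0005:L1] -/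
theorem TMem.congr {f g : ℝ → ℝ} {P : IPoly} (hf : TMem S h f P)
    (hfg : ∀ ρ : ℝ, |ρ| ≤ h → f ρ = g ρ) : TMem S h g P := fun ρ hρ => by
  obtain ⟨as, has, e⟩ := hf ρ hρ
  exact ⟨as, has, by rw [← hfg ρ hρ, e]⟩

/-! ### Left folds of sums -/

/-- **Folded sums of Taylor models.**  If the accumulator `A` encloses `a` and, for every position
`i` of the list `l`, `G l[i]` encloses `g i`, then `l.foldl (fun acc p ↦ taddI acc (G p)) A`
encloses `ρ ↦ a ρ + Σ_{i < |l|} g i ρ`. [cite: MakinoBerz2003, Def 2 (addition of Taylor models) with Thm 2 (FTTMA: a finite code list of Taylor-model operations encloses the composite), §2 (chunks p0005:L11, p0009:L7 of paper:galaxy-pdf-578413100)] -/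
theorem tmem_foldl_taddI {ι : Type*} (G : ι → IPoly) :
    ∀ (l : List ι) (g : ℕ → ℝ → ℝ)
      (_ : ∀ (i : ℕ) (hi : i < l.length), TMem S h (g i) (G l[i]))
      {a : ℝ → ℝ} {A : IPoly} (_ : TMem S h a A),
      TMem S h (fun ρ => a ρ + ∑ i ∈ range l.length, g i ρ)
        (l.foldl (fun acc p => taddI acc (G p)) A)
  | [], g, _, a, A, ha => ha.congr fun ρ _ => by simp
  | p :: l, g, hg, a, A, ha => by
      rw [List.foldl_cons]
      have hg0 : TMem S h (g 0) (G p) := hg 0 (by simp)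
      have ih := tmem_foldl_taddI G l (fun i => g (i + 1))
        (fun i hi => hg (i + 1) (by simpa using Nat.succ_lt_succ hi)) (tmem_add ha hg0)
      refine ih.congr fun ρ _ => ?_
      rw [List.length_cons, sum_range_succ']
      ring

/-- **Folded sums of intervals.**  If `A` encloses `a` and `l[i]` encloses `x i` for every position
`i`, then `l.foldl MI.add A` encloses `a + Σ_{i < |l|} x i` (interval addition is the degree-0 case
of Taylor-model addition). [cite: MakinoBerz2003, Def 2 (addition of Taylor models) with Thm 2 (FTTMA: a finite code list of Taylor-model operations encloses the composite), §2 (chunks p0005:L11, p0009:L7 of paper:galaxy-pdf-578413100)] -/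
theorem mem_foldl_add_list :
    ∀ (l : List MI) (x : ℕ → ℝ) (_ : ∀ (i : ℕ) (hi : i < l.length), MI.mem S (x i) l[i])
      {a : ℝ} {A : MI} (_ : MI.mem S a A),
      MI.mem S (a + ∑ i ∈ range l.length, x i) (l.foldl MI.add A)
  | [], x, _, a, A, ha => by simpa using ha
  | I :: l, x, hx, a, A, ha => by
      rw [List.foldl_cons]
      have hx0 : MI.mem S (x 0) I := hx 0 (by simp)
      have ih := mem_foldl_add_list l (fun i => x (i + 1))
        (fun i hi => hx (i + 1) (by simpa using Nat.succ_lt_succ hi)) (MI.mem_add ha hx0)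
      have e : a + x 0 + ∑ i ∈ range l.length, x (i + 1) = a + ∑ i ∈ range (I :: l).length, x i := by
        rw [List.length_cons, sum_range_succ']
        ring
      rw [← e]
      exact ih

/-- The interval sum of a list: `Σ_i l_i`, one left fold from the thin `0`. [cite: MakinoBerz2003, Def 2 (addition of Taylor models) with Thm 2 (FTTMA: a finite code list of Taylor-model operations encloses the composite), §2 (chunks p0005:L11, p0009:L7 of paper:galaxy-pdf-578413100)] -/
def sumMI (S : ℕ) (l : List MI) : MI := l.foldl MI.add (MI.ofInt S 0)

/-- `sumMI` encloses the sum of the enclosed reals. [cite: MakinoBerz2003, Def 2 (addition of Taylor models) with Thm 2 (FTTMA: a finite code list of Taylor-model operations encloses the composite), §2 (chunks p0005:L11, p0009:L7 of paper:galaxy-pdf-578413100)] -/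
theorem mem_sumMI {l : List MI} {x : ℕ → ℝ}
    (hx : ∀ (i : ℕ) (hi : i < l.length), MI.mem S (x i) l[i]) :
    MI.mem S (∑ i ∈ range l.length, x i) (sumMI S l) := by
  have := mem_foldl_add_list l x hx (MI.mem_ofInt S 0)
  simpa [sumMI] using this

/-! ### Linear combinations with interval scalars -/

/-- `Σ_k c_k · P_k`: linear combination of the Taylor models `P_k` with interval scalars `c_k`
(lists `[c_0, c_1, …]`, `[P_0, P_1, …]`, extra entries of the longer list ignored), one left fold.
[cite: MakinoBerz2003, Def 2 (addition, multiplication) and §2 «scalar multiplication»/«addition» algorithms (chunks p0013:L7, p0014:L1) with Thm 2 (FTTMA), chunk p0009:L7] -/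
def tlinComb (S : ℕ) (cs : List MI) (Ps : List IPoly) : IPoly :=
  (cs.zip Ps).foldl (fun acc p => taddI acc (tsmulI S p.1 p.2)) (tconst (MI.ofInt S 0))

/-- **Soundness of `tlinComb`.**  If `cs[i]` encloses `c i` and `Ps[i]` encloses `f i`, then
`tlinComb S cs Ps` encloses `ρ ↦ Σ_{i < min |cs| |Ps|} c i · f i ρ`. [cite: MakinoBerz2003, Def 2 (addition, multiplication) and §2 «scalar multiplication»/«addition» algorithms (chunks p0013:L7, p0014:L1) with Thm 2 (FTTMA), chunk p0009:L7] -/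
theorem tmem_linComb (hS : 0 < S) {cs : List MI} {Ps : List IPoly} {c : ℕ → ℝ}
    {f : ℕ → ℝ → ℝ} (hc : ∀ (i : ℕ) (hi : i < cs.length), MI.mem S (c i) cs[i])
    (hf : ∀ (i : ℕ) (hi : i < Ps.length), TMem S h (f i) Ps[i]) :
    TMem S h (fun ρ => ∑ i ∈ range (min cs.length Ps.length), c i * f i ρ) (tlinComb S cs Ps) := by
  have hz : TMem S h (fun _ => ((0 : ℤ) : ℝ)) (tconst (MI.ofInt S 0)) := tmem_const (MI.mem_ofInt S 0)
  have key := tmem_foldl_taddI (S := S) (h := h) (fun p : MI × IPoly => tsmulI S p.1 p.2) (cs.zip Ps)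
    (fun i ρ => c i * f i ρ)
    (fun i hi => by
      have hi' := hi
      rw [List.length_zip] at hi'
      rw [List.getElem_zip]
      exact tmem_smulI hS (hc i (lt_min_iff.mp hi').1) (hf i (lt_min_iff.mp hi').2)) hz
  refine key.congr fun ρ _ => ?_
  simp [List.length_zip]

/-- `tmem_linComb` for lists of equal length `n`: the sum runs over `range n`. [cite: MakinoBerz2003, Def 2 (addition, multiplication) and §2 «scalar multiplication»/«addition» algorithms (chunks p0013:L7, p0014:L1) with Thm 2 (FTTMA), chunk p0009:L7] -/
theorem tmem_linComb_of_length_eq (hS : 0 < S) {n : ℕ} {cs : List MI} {Ps : List IPoly}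
    (hcs : cs.length = n) (hPs : Ps.length = n) {c : ℕ → ℝ} {f : ℕ → ℝ → ℝ}
    (hc : ∀ (i : ℕ) (hi : i < cs.length), MI.mem S (c i) cs[i])
    (hf : ∀ (i : ℕ) (hi : i < Ps.length), TMem S h (f i) Ps[i]) :
    TMem S h (fun ρ => ∑ i ∈ range n, c i * f i ρ) (tlinComb S cs Ps) := by
  have := tmem_linComb hS hc hf
  rwa [hcs, hPs, min_self] at this

/-- `tmem_linComb` in the `Fin n`-indexed form (`List.ofFn`). [cite: MakinoBerz2003, Def 2 (addition, multiplication) and §2 «scalar multiplication»/«addition» algorithms (chunks p0013:L7, p0014:L1) with Thm 2 (FTTMA), chunk p0009:L7] -/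
theorem tmem_linComb_ofFn (hS : 0 < S) {n : ℕ} {C : Fin n → MI} {P : Fin n → IPoly}
    {c : Fin n → ℝ} {f : Fin n → ℝ → ℝ}
    (hc : ∀ i, MI.mem S (c i) (C i)) (hf : ∀ i, TMem S h (f i) (P i)) :
    TMem S h (fun ρ => ∑ i : Fin n, c i * f i ρ) (tlinComb S (List.ofFn C) (List.ofFn P)) := by
  classical
  set c' : ℕ → ℝ := fun i => if hi : i < n then c ⟨i, hi⟩ else 0 with hc'
  set f' : ℕ → ℝ → ℝ := fun i => if hi : i < n then f ⟨i, hi⟩ else 0 with hf'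
  have key := tmem_linComb_of_length_eq hS (h := h) (cs := List.ofFn C) (Ps := List.ofFn P)
    (List.length_ofFn (f := C)) (List.length_ofFn (f := P)) (c := c') (f := f')
    (fun i hi => by
      have hin : i < n := by simpa using hi
      simp only [List.getElem_ofFn, hc', dif_pos hin]
      exact hc _)
    (fun i hi => by
      have hin : i < n := by simpa using hi
      simp only [List.getElem_ofFn, hf', dif_pos hin]
      exact hf _)
  refine key.congr fun ρ _ => ?_
  rw [Finset.sum_range (fun i => c' i * f' i ρ)]
  refine Finset.sum_congr rfl fun i _ => ?_
  simp [hc', hf', i.isLt]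

/-! ### Powers of a Taylor model -/

/-- `U^k` by iterated truncated products: `U^0 = 1`, `U^{k+1} = U · U^k`. [cite: MakinoBerz2003, Def 2 (multiplication, truncated at order n) with Thm 2 (FTTMA); powers of a Taylor model as in Def 3 eq. (2.2) (chunks p0005:L11–L37, p0009:L7)] -/
def tpow (S : ℕ) (h : ℚ) (D : ℕ) (U : IPoly) : ℕ → IPoly
  | 0 => tconst (MI.ofInt S 1)
  | k + 1 => tmulI S h D U (tpow S h D U k)

/-- `tpow` encloses the powers. [cite: MakinoBerz2003, Def 2 (multiplication, truncated at order n) with Thm 2 (FTTMA); powers of a Taylor model as in Def 3 eq. (2.2) (chunks p0005:L11–L37, p0009:L7)] -/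
theorem tmem_tpow (hS : 0 < S) (h0 : 0 ≤ h) (D : ℕ) {u : ℝ → ℝ} {U : IPoly} (hu : TMem S h u U) :
    ∀ k : ℕ, TMem S h (fun ρ => u ρ ^ k) (tpow S h D U k)
  | 0 => (tmem_const (MI.mem_ofInt S 1)).congr fun ρ _ => by simp
  | k + 1 => (tmem_mul hS h0 D hu (tmem_tpow hS h0 D hu k)).congr fun ρ _ => by ring

/-- The list of powers `[U^0, U^1, …, U^m]`, computed by one left fold (the accumulator holds the
powers computed so far, most recent first). [cite: MakinoBerz2003, Def 2 (multiplication, truncated at order n) with Thm 2 (FTTMA); powers of a Taylor model as in Def 3 eq. (2.2) (chunks p0005:L11–L37, p0009:L7)] -/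
def tpowers (S : ℕ) (h : ℚ) (D : ℕ) (U : IPoly) (m : ℕ) : List IPoly :=
  ((List.range m).foldl
      (fun (acc : List IPoly) _ => (tmulI S h D U (acc.headD (tconst (MI.ofInt S 1)))) :: acc)
      [tconst (MI.ofInt S 1)]).reverse

/-- The fold of `tpowers`, started from the reversed list `[U^k, …, U^0]`, appends the next
`|l|` powers (plumbing for `tpowers_eq`). [folklore] -/
private theorem foldl_tpow_aux (S : ℕ) (h : ℚ) (D : ℕ) (U : IPoly) : ∀ (l : List ℕ) (k : ℕ),
    l.foldl (fun (acc : List IPoly) _ => (tmulI S h D U (acc.headD (tconst (MI.ofInt S 1)))) :: acc)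
        (((List.range (k + 1)).map (tpow S h D U)).reverse) =
      ((List.range (k + l.length + 1)).map (tpow S h D U)).reverse
  | [], k => by simp
  | x :: l, k => by
      rw [List.foldl_cons]
      have hhead : (((List.range (k + 1)).map (tpow S h D U)).reverse).headD (tconst (MI.ofInt S 1)) =
          tpow S h D U k := by
        rw [List.range_succ, List.map_append, List.reverse_append]
        simp
      rw [hhead]
      have hcons : tmulI S h D U (tpow S h D U k) :: ((List.range (k + 1)).map (tpow S h D U)).reverse =
          ((List.range (k + 1 + 1)).map (tpow S h D U)).reverse := by
        rw [List.range_succ (n := k + 1), List.map_append, List.reverse_append]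
        simp [tpow]
      rw [hcons, foldl_tpow_aux S h D U l (k + 1), List.length_cons]
      congr 3
      omega

/-- `tpowers` IS the list of the `tpow`'s. [cite: MakinoBerz2003, Def 2 (multiplication, truncated at order n) with Thm 2 (FTTMA); powers of a Taylor model as in Def 3 eq. (2.2) (chunks p0005:L11–L37, p0009:L7)] -/
theorem tpowers_eq (S : ℕ) (h : ℚ) (D : ℕ) (U : IPoly) (m : ℕ) :
    tpowers S h D U m = (List.range (m + 1)).map (tpow S h D U) := by
  unfold tpowers
  have h0 : [tconst (MI.ofInt S 1)] = ((List.range (0 + 1)).map (tpow S h D U)).reverse := by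
    simp [tpow]
  rw [h0, foldl_tpow_aux, List.reverse_reverse, List.length_range]
  congr 2
  omega

/-- `tpowers S h D U m` has `m + 1` entries. [cite: MakinoBerz2003, Def 2 (multiplication, truncated at order n) with Thm 2 (FTTMA); powers of a Taylor model as in Def 3 eq. (2.2) (chunks p0005:L11–L37, p0009:L7)] -/
theorem length_tpowers (S : ℕ) (h : ℚ) (D : ℕ) (U : IPoly) (m : ℕ) :
    (tpowers S h D U m).length = m + 1 := by
  simp [tpowers_eq]

/-- Entry `i ≤ m` of `tpowers` is `tpow … i`. [cite: MakinoBerz2003, Def 2 (multiplication, truncated at order n) with Thm 2 (FTTMA); powers of a Taylor model as in Def 3 eq. (2.2) (chunks p0005:L11–L37, p0009:L7)] -/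
theorem tpowers_getD {S : ℕ} {h : ℚ} {D : ℕ} {U : IPoly} {m i : ℕ} (hi : i ≤ m) (d : IPoly) :
    (tpowers S h D U m).getD i d = tpow S h D U i := by
  rw [tpowers_eq, List.getD_eq_getElem?_getD, List.getElem?_map, List.getElem?_range (by omega)]
  simp

/-- **Soundness of `tpowers`.**  `(tpowers S h D U m).getD i []` encloses `ρ ↦ u ρ ^ i` for every
`i ≤ m`. [cite: MakinoBerz2003, Def 2 (multiplication, truncated at order n) with Thm 2 (FTTMA); powers of a Taylor model as in Def 3 eq. (2.2) (chunks p0005:L11–L37, p0009:L7)] -/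
theorem tmem_powers (hS : 0 < S) (h0 : 0 ≤ h) {D : ℕ} {u : ℝ → ℝ} {U : IPoly}
    (hu : TMem S h u U) (m : ℕ) {i : ℕ} (hi : i ≤ m) :
    TMem S h (fun ρ => u ρ ^ i) ((tpowers S h D U m).getD i []) := by
  rw [tpowers_getD hi]
  exact tmem_tpow hS h0 D hu i

/-- `tmem_powers`, indexed access form. [cite: MakinoBerz2003, Def 2 (multiplication, truncated at order n) with Thm 2 (FTTMA); powers of a Taylor model as in Def 3 eq. (2.2) (chunks p0005:L11–L37, p0009:L7)] -/
theorem tmem_powers_getElem (hS : 0 < S) (h0 : 0 ≤ h) {D : ℕ} {u : ℝ → ℝ} {U : IPoly}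
    (hu : TMem S h u U) (m : ℕ) {i : ℕ} (hi : i < (tpowers S h D U m).length) :
    TMem S h (fun ρ => u ρ ^ i) (tpowers S h D U m)[i] := by
  have him : i ≤ m := by rw [length_tpowers] at hi; omega
  have := tmem_powers hS h0 (D := D) hu m him
  rwa [List.getD_eq_getElem?_getD, List.getElem?_eq_getElem hi, Option.getD_some] at this

/-- **`Σ_i R_i(ρ) · u(ρ)^i` with Taylor-model coefficients.**  If `Rs[i]` encloses `r i`
(`i < |Rs| ≤ m + 1`) and `U` encloses `u`, then the fold
`Σ_{(R,i) ∈ Rs.zip (range n)} (U^i from tpowers) · R` encloses `ρ ↦ Σ_{i < min |Rs| n} r i ρ · u ρ ^ i`.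
[cite: MakinoBerz2003, Thm 2 (FTTMA) and §2 «all intrinsic functions can be expressed as linear combinations of monomials of Taylor models» (chunk p0015:L3); Def 2] -/
theorem tmem_foldl_mul_powers (hS : 0 < S) (h0 : 0 ≤ h) {D m n : ℕ} {Rs : List IPoly}
    {r : ℕ → ℝ → ℝ} {u : ℝ → ℝ} {U : IPoly}
    (hR : ∀ (i : ℕ) (hi : i < Rs.length), TMem S h (r i) Rs[i]) (hu : TMem S h u U)
    (hm : min Rs.length n ≤ m + 1) :
    TMem S h (fun ρ => ∑ i ∈ range (min Rs.length n), r i ρ * u ρ ^ i)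
      ((Rs.zip (List.range n)).foldl
        (fun acc p => taddI acc (tmulI S h D ((tpowers S h D U m).getD p.2 []) p.1))
        (tconst (MI.ofInt S 0))) := by
  have hz : TMem S h (fun _ => ((0 : ℤ) : ℝ)) (tconst (MI.ofInt S 0)) := tmem_const (MI.mem_ofInt S 0)
  have key := tmem_foldl_taddI (S := S) (h := h)
    (fun p : IPoly × ℕ => tmulI S h D ((tpowers S h D U m).getD p.2 []) p.1) (Rs.zip (List.range n))
    (fun i ρ => u ρ ^ i * r i ρ)
    (fun i hi => by
      have hi' := hi
      rw [List.length_zip, List.length_range] at hi'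
      rw [List.getElem_zip, List.getElem_range]
      exact tmem_mul hS h0 D (tmem_powers hS h0 hu m (by omega)) (hR i (lt_min_iff.mp hi').1)) hz
  refine key.congr fun ρ _ => ?_
  simp [List.length_zip, mul_comm]

/-! ### Horner evaluation with interval coefficients -/

/-- `Σ_k cs_k · U^k` by Horner's rule: `c_0 + U · (c_1 + U · (…))`. [cite: MakinoBerz2003, Thm 2 (FTTMA) and §2 «all intrinsic functions can be expressed as linear combinations of monomials of Taylor models» (chunk p0015:L3); Def 2] -/
def thornerMI (S : ℕ) (h : ℚ) (D : ℕ) : List MI → IPoly → IPoly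
  | [], _ => tconst (MI.ofInt S 0)
  | c :: cs, U => taddI (tconst c) (tmulI S h D U (thornerMI S h D cs U))

/-- **Soundness of `thornerMI`.**  If `cs[i]` encloses `c i` and `U` encloses `u`, then
`thornerMI S h D cs U` encloses `ρ ↦ Σ_{i < |cs|} c i · u ρ ^ i`. [cite: MakinoBerz2003, Thm 2 (FTTMA) and §2 «all intrinsic functions can be expressed as linear combinations of monomials of Taylor models» (chunk p0015:L3); Def 2] -/
theorem tmem_thornerMI (hS : 0 < S) (h0 : 0 ≤ h) (D : ℕ) {u : ℝ → ℝ} {U : IPoly}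
    (hu : TMem S h u U) :
    ∀ (cs : List MI) (c : ℕ → ℝ) (_ : ∀ (i : ℕ) (hi : i < cs.length), MI.mem S (c i) cs[i]),
      TMem S h (fun ρ => ∑ i ∈ range cs.length, c i * u ρ ^ i) (thornerMI S h D cs U)
  | [], c, _ => (tmem_const (MI.mem_ofInt S 0)).congr fun ρ _ => by simp
  | C :: cs, c, hc => by
      have hC : MI.mem S (c 0) C := hc 0 (by simp)
      have ih := tmem_thornerMI hS h0 D hu cs (fun i => c (i + 1))
        (fun i hi => hc (i + 1) (by simpa using Nat.succ_lt_succ hi))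
      refine (tmem_add (tmem_const hC) (tmem_mul hS h0 D hu ih)).congr fun ρ _ => ?_
      rw [List.length_cons, sum_range_succ', mul_sum, pow_zero, mul_one, add_comm]
      refine congrArg (· + c 0) (sum_congr rfl fun i _ => ?_)
      ring

/-- **`Σ_i R_i(ρ) · u(ρ)^i`, `zipIdx` form.**  The same as `tmem_foldl_mul_powers` for the fold over
`Rs.zipIdx` (pairs `(R_i, i)`), the shape in which a certificate pairs each coefficient model with
its power index without a separate index list: if `Rs[i]` encloses `r i` (`|Rs| ≤ m + 1`) and `U`
encloses `u`, the fold encloses `ρ ↦ Σ_{i < |Rs|} r i ρ · u ρ ^ i`.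
[cite: MakinoBerz2003, Thm 2 (FTTMA) and §2 «all intrinsic functions can be expressed as linear combinations of monomials of Taylor models» (chunk p0015:L3); Def 2] -/
theorem tmem_foldl_zipIdx_mul_powers (hS : 0 < S) (h0 : 0 ≤ h) {D m : ℕ} {Rs : List IPoly}
    {r : ℕ → ℝ → ℝ} {u : ℝ → ℝ} {U : IPoly}
    (hR : ∀ (i : ℕ) (hi : i < Rs.length), TMem S h (r i) Rs[i]) (hu : TMem S h u U)
    (hm : Rs.length ≤ m + 1) :
    TMem S h (fun ρ => ∑ i ∈ range Rs.length, r i ρ * u ρ ^ i)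
      (Rs.zipIdx.foldl
        (fun acc p => taddI acc (tmulI S h D ((tpowers S h D U m).getD p.2 []) p.1))
        (tconst (MI.ofInt S 0))) := by
  have hz : TMem S h (fun _ => ((0 : ℤ) : ℝ)) (tconst (MI.ofInt S 0)) := tmem_const (MI.mem_ofInt S 0)
  have key := tmem_foldl_taddI (S := S) (h := h)
    (fun p : IPoly × ℕ => tmulI S h D ((tpowers S h D U m).getD p.2 []) p.1) Rs.zipIdx
    (fun i ρ => u ρ ^ i * r i ρ)
    (fun i hi => by
      have hi' : i < Rs.length := by simpa using hi
      have hp := tmem_powers (D := D) hS h0 hu m (show i ≤ m by omega)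
      rw [List.getElem_zipIdx]
      simpa using tmem_mul hS h0 D hp (hR i hi')) hz
  refine key.congr fun ρ _ => ?_
  simp [mul_comm]

/-- **A product of two Taylor models followed by the `zipIdx` power sum** (`u · Σ_i R_i u^i`, the
shape `J = tmulI U (fold …)`): encloses `ρ ↦ u ρ · Σ_{i<|Rs|} r i ρ · u ρ ^ i`.
[cite: MakinoBerz2003, Thm 2 (FTTMA) and §2 «all intrinsic functions can be expressed as linear combinations of monomials of Taylor models» (chunk p0015:L3); Def 2] -/
theorem tmem_mul_foldl_zipIdx_mul_powers (hS : 0 < S) (h0 : 0 ≤ h) {D m : ℕ} {Rs : List IPoly}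
    {r : ℕ → ℝ → ℝ} {u : ℝ → ℝ} {U : IPoly}
    (hR : ∀ (i : ℕ) (hi : i < Rs.length), TMem S h (r i) Rs[i]) (hu : TMem S h u U)
    (hm : Rs.length ≤ m + 1) (hm1 : 1 ≤ m) :
    TMem S h (fun ρ => u ρ * ∑ i ∈ range Rs.length, r i ρ * u ρ ^ i)
      (tmulI S h D ((tpowers S h D U m).getD 1 [])
        (Rs.zipIdx.foldl
          (fun acc p => taddI acc (tmulI S h D ((tpowers S h D U m).getD p.2 []) p.1))
          (tconst (MI.ofInt S 0)))) := by
  have h1 : TMem S h (fun ρ => u ρ ^ 1) ((tpowers S h D U m).getD 1 []) :=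
    tmem_powers (D := D) hS h0 hu m hm1
  exact (tmem_mul hS h0 D h1 (tmem_foldl_zipIdx_mul_powers hS h0 hR hu hm)).congr
    fun ρ _ => by simp

end PolyMP

end Literature.Analysis.ValidatedNumerics
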